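import Literature.Combinatorics.Kakeya.Tao2005Quadric
import Literature.Combinatorics.Kakeya.Tao2005UnitSphere

/-!
# The split form `⟨x, x⟩ = det x` as an instance of the general unit-sphere setting
(Tao 2005, Proposition 1.3)

Topic `Literature/Combinatorics/Kakeya`.  Everything in this file is PROVED.  It links the two
formalizations of T. Tao, *A new bound for finite field Besicovitch sets in four dimensions*,
Pacific J. Math. **222** (2005), 337–363, Proposition 1.3 (§1, p. 338):
`Literature.Combinatorics.Kakeya.Tao2005Quadric` (the split quadric `Z = {det = 1} = SL₂(K)` in
`M₂(K) ≅ K⁴`, exact counts) and `Literature.Combinatorics.Kakeya.Tao2005UnitSphere` (an arbitrary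
nondegenerate symmetric bilinear form on a `4`-space, explicit constants).

* `detForm` — the symmetric bilinear form `⟨X, Y⟩ = ½ (X₀₀ Y₁₁ + X₁₁ Y₀₀ − X₀₁ Y₁₀ − X₁₀ Y₀₁)`
  on `M₂(K)`, the polarisation of `det` (`detForm_apply_self`: `⟨X, X⟩ = det X` when
  `char K ≠ 2`); `detForm_isSymm`, `detForm_nondegenerate`.
* `sphere_detForm` — its unit sphere is `Tao2005Quadric.Z`; `lineSet_detForm` — its line family
  `L` is `Tao2005Quadric.linesInZ` (`char K ≠ 2`, `|K| ≥ 3`): the split file's `Z`, `linesInZ`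
  are exactly Tao's `P`, `L` for this form, as asserted in that file's module docstring.
* `prop13_split_general` — consequently the general theorem `Tao2005UnitSphere.prop13` applies to
  `Z`: e.g. every affine `3`-space `x₀ + U` of `M₂(𝔽_q)` contains at most `8 q` lines of `Z` and
  `(q − 2)³ ≤ #linesInZ ≤ 6 q³` (the split file has the exact values).

## References
* [Tao2005FiniteFieldBesicovitch4D] T. Tao, Pacific J. Math. 222 (2005), no. 2, 337–363,
  Prop. 1.3 (§1, p. 338).
-/

namespace Literature.Combinatorics.Kakeya

namespace Tao2005UnitSphere

open Module Matrix

variable {K : Type*} [Field K]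

/-- The polar bilinear form of the determinant on `M₂(K)`:
`⟨X, Y⟩ = ½ (X₀₀ Y₁₁ + X₁₁ Y₀₀ − X₀₁ Y₁₀ − X₁₀ Y₀₁)` (for `char K = 2`, where `½ = 0` in Lean, it
is the zero form and not used). [folklore] -/
def detForm : LinearMap.BilinForm K (Matrix (Fin 2) (Fin 2) K) :=
  LinearMap.mk₂ K
    (fun X Y => (2 : K)⁻¹ * (X 0 0 * Y 1 1 + X 1 1 * Y 0 0 - X 0 1 * Y 1 0 - X 1 0 * Y 0 1))
    (fun X X' Y => by simp only [Matrix.add_apply]; ring)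
    (fun c X Y => by simp only [Matrix.smul_apply, smul_eq_mul]; ring)
    (fun X Y Y' => by simp only [Matrix.add_apply]; ring)
    (fun c X Y => by simp only [Matrix.smul_apply, smul_eq_mul]; ring)

/-- The defining formula of `detForm`. [folklore] -/
theorem detForm_apply (X Y : Matrix (Fin 2) (Fin 2) K) :
    detForm X Y = (2 : K)⁻¹ * (X 0 0 * Y 1 1 + X 1 1 * Y 0 0 - X 0 1 * Y 1 0 - X 1 0 * Y 0 1) :=
  rfl

/-- `⟨X, X⟩ = det X` (`char K ≠ 2`). [folklore] -/
theorem detForm_apply_self (h2 : (2 : K) ≠ 0) (X : Matrix (Fin 2) (Fin 2) K) :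
    detForm X X = X.det := by
  rw [detForm_apply, Matrix.det_fin_two]
  field_simp
  ring

/-- `detForm` is symmetric. [folklore] -/
theorem detForm_isSymm : (detForm (K := K)).IsSymm :=
  ⟨fun X Y => by rw [detForm_apply, detForm_apply]; ring⟩

/-- `detForm` is nondegenerate (`char K ≠ 2`). [folklore] -/
theorem detForm_nondegenerate (h2 : (2 : K) ≠ 0) : (detForm (K := K)).Nondegenerate := by
  have h2' : (2 : K)⁻¹ ≠ 0 := inv_ne_zero h2
  have sep : ∀ X : Matrix (Fin 2) (Fin 2) K, (∀ Y, detForm X Y = 0) → X = 0 := by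
    intro X hX
    have h00 := hX !![0, 0; 0, 1]
    have h11 := hX !![1, 0; 0, 0]
    have h01 := hX !![0, 0; 1, 0]
    have h10 := hX !![0, 1; 0, 0]
    simp only [detForm_apply, Matrix.of_apply, Matrix.cons_val', Matrix.cons_val_zero,
      Matrix.cons_val_one, Matrix.cons_val_fin_one, Matrix.empty_val', mul_zero, mul_one,
      add_zero, zero_add, sub_zero, zero_sub, mul_eq_zero, h2', false_or, neg_eq_zero]
      at h00 h11 h01 h10
    ext i j
    fin_cases i <;> fin_cases j
    · exact h00
    · simpa using h01
    · simpa using h10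
    · exact h11
  refine ⟨sep, fun Y hY => sep Y (fun X => ?_)⟩
  rw [detForm_isSymm.eq Y X]
  exact hY X

/-- **The unit sphere of `detForm` is the split quadric `Z = {det = 1}`** of
`Tao2005Quadric`. [cite: Tao2005FiniteFieldBesicovitch4D, Prop. 1.3 (§1, p. 338)] -/
theorem sphere_detForm (h2 : (2 : K) ≠ 0) :
    sphere (detForm (K := K)) = Tao2005Quadric.Z := by
  ext X
  rw [mem_sphere_iff, detForm_apply_self h2]
  rfl

/-- The two files' parametrised lines agree. [folklore] -/
theorem line_eq_line (P V : Matrix (Fin 2) (Fin 2) K) :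
    line K P V = Tao2005Quadric.line P V :=
  rfl

/-- **The line family `L` of `detForm` is `Tao2005Quadric.linesInZ`**, the set of all lines
contained in `Z` (`char K ≠ 2`, `|K| ≥ 3`).
[cite: Tao2005FiniteFieldBesicovitch4D, Prop. 1.3 (§1, p. 338)] -/
theorem lineSet_detForm (h2 : (2 : K) ≠ 0) (h3 : ∃ c : K, c ≠ 0 ∧ c ≠ 1) :
    lineSet (detForm (K := K)) = Tao2005Quadric.linesInZ := by
  ext ℓ
  rw [mem_lineSet_iff detForm_isSymm h2 h3, sphere_detForm h2]
  constructor
  · rintro ⟨x, v, hv, hsub, rfl⟩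
    exact ⟨x, v, hv, rfl, hsub⟩
  · rintro ⟨x, v, hv, rfl, hsub⟩
    exact ⟨x, v, hv, hsub, rfl⟩

/-- **The general Proposition 1.3 (`Tao2005UnitSphere.prop13`) specialised to the split form:**
for `K = 𝔽_q`, `q` odd, the split quadric `Z` contains all the lines of `linesInZ`,
`q (q − 2)² ≤ |Z| ≤ 2 q³`, `(q − 2)³ ≤ #linesInZ ≤ 6 q³`, every affine `2`-plane `x₀ + W` contains
at most `2` and every affine `3`-space `x₀ + U` at most `8 q` lines of `Z` (the companion file
`Tao2005Quadric` proves the exact values `|Z| = q (q² − 1)`, `#linesInZ = (q − 1)(q + 1)²` and the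
sharp `2 (q + 1)` for `3`-spaces).
[cite: Tao2005FiniteFieldBesicovitch4D, Prop. 1.3 (§1, p. 338)] -/
theorem prop13_split_general [Finite K] (h2 : (2 : K) ≠ 0) :
    (∀ ℓ ∈ (Tao2005Quadric.linesInZ : Set (Set (Matrix (Fin 2) (Fin 2) K))),
        ℓ ⊆ Tao2005Quadric.Z) ∧
      (Nat.card K * ((Nat.card K - 2) * (Nat.card K - 2)) ≤
          (Tao2005Quadric.Z : Set (Matrix (Fin 2) (Fin 2) K)).ncard ∧
        (Tao2005Quadric.Z : Set (Matrix (Fin 2) (Fin 2) K)).ncard ≤ 2 * Nat.card K ^ 3) ∧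
      ((Nat.card K - 2) ^ 3 ≤
          (Tao2005Quadric.linesInZ : Set (Set (Matrix (Fin 2) (Fin 2) K))).ncard ∧
        (Tao2005Quadric.linesInZ : Set (Set (Matrix (Fin 2) (Fin 2) K))).ncard ≤
          6 * Nat.card K ^ 3) ∧
      (∀ (W : Submodule K (Matrix (Fin 2) (Fin 2) K)) (x₀ : Matrix (Fin 2) (Fin 2) K),
        finrank K W = 2 →
          (lineSetIn (detForm (K := K)) (translate x₀ W)).ncard ≤ 2) ∧
      ∀ (U : Submodule K (Matrix (Fin 2) (Fin 2) K)) (x₀ : Matrix (Fin 2) (Fin 2) K),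
        finrank K U = 3 →
          (lineSetIn (detForm (K := K)) (translate x₀ U)).ncard ≤ 8 * Nat.card K := by
  have h3 : ∃ c : K, c ≠ 0 ∧ c ≠ 1 := by
    classical
    haveI := Fintype.ofFinite K
    have hq := two_lt_card (K := K) h2
    rw [Nat.card_eq_fintype_card] at hq
    exact Tao2005Quadric.two_lt_card_iff.1 hq
  have h4 : finrank K (Matrix (Fin 2) (Fin 2) K) = 4 := by
    simp [Module.finrank_matrix, Fintype.card_fin]
  have h := prop13 (detForm_nondegenerate h2) detForm_isSymm h2 h4
  rw [sphere_detForm h2, lineSet_detForm h2 h3] at h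
  exact h

end Tao2005UnitSphere

end Literature.Combinatorics.Kakeya
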